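import Summits.KontsevichZagierPeriods.Zeta5Search.WedgeDictionaryLevelDescentFace
import HarnessLib

/-!
# Level descent (LD@N) — the EXTENDED face `b₁ + b₂ = N` (wedge side) — PROVED

HONEST FRAMING: systematic search; no irrationality claim unless certified.

gen-1 g7 (planner-pub-zeta5-gen-1-g7-0), written for P1's lane (P1 g4 silent since 08:42Z; lead/lit g6 files staged files verbatim):
the WEDGE SIDE of the base case S4 of the level-descent induction (design memo `HOME/pub-zeta5-gen-1/D2-LD-PROOF-g7.md` §4, §9).
P1's `LevelDescent.levelDescent_face` (p212625) treats the face `b₁ = b₂ = N/2`; the induction over the region `R` bottoms out on the whole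
hyperplane `c₁₂ = N − b₁ − b₂ = 0`. The mechanism is P1's, verbatim: the degenerate shape `b♭ = (N; N+1, 0, b₃, …, b₇)` has
`numPoly b♭ = numPoly b · (X + b₁)(X + b₂)` as soon as `b₁ + b₂ = N` (the two special slots regroup as `(X)_{b₁}(X+b₁)(X+b₁+1)_{b₂} = (X)_{N+1}`
and symmetrically), so `numPoly b♭ − numPoly(b + e_j) = (b₁b₂ − b_j(N − b_j))·numPoly b` is an exact numerator identity (zero telescoper) and
`U(b♭) = 0` by the pole-order drop `LevelDescent.coeffU_eq_zero_of_sq_dvd`.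

* `numPoly_faceShape_ext`, `faceShape_box_ext`;
* `levelDescent_faceExt`: for `b₁ + b₂ = N ≥ 1`, `d(b) ≥ 0`, `j ∈ {3,…,7}`, `b_j ≤ N`:
  `U(b♭) = 0`, `U(b+e_j) = (b_j(N−b_j) − b₁b₂)·U(b)`, `U(b)W(b+e_j) − U(b+e_j)W(b) = U(b)·W(b♭)`, and the same with `V`;
* `ldFaceWedge_stmt` / `ldFaceWedge_holds`: the slot-7 instance, packaged as a named statement (the form the induction's base case S4 consumes:
  on the face, `casUW b = U(b)·W(b♭)`, `casUV b = U(b)·V(b♭)`, and `b♭ = degShape b 0`).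

What this is NOT: the VALUE of `U(b)` on the extended face (`coeffU_faceExt_stmt` of `…LevelDescentWeights`, OPEN — P1's `coeffU_face_closed`
covers `b₁ = b₂`), nor the induction; nothing about irrationality.
-/


open Finset Polynomial

namespace Summit.KontsevichZagierPeriods.Zeta5Search.WedgeDictionary

open Summit.KontsevichZagierPeriods.Zeta5Search.DualSeries
open Literature.NumberTheory.Transcendental (BallRivoal.poch)
open Literature.NumberTheory.Transcendental.BallRivoal (pochPoly eval_pochPoly pfEval)

namespace LevelDescent

/-- **The numerator identity of the extended face**: for `b₁ + b₂ = N`: `numPoly b♭ = numPoly b · (X + b₁)(X + b₂)`. -/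
theorem numPoly_faceShape_ext (b : ℕ → ℤ) (h1 : 0 ≤ b 1) (h2 : 0 ≤ b 2) (h12 : b 1 + b 2 = b 0) :
    numPoly (faceShape b) = numPoly b * ((X + C (b 1 : ℚ)) * (X + C (b 2 : ℚ))) := by
  set β₁ := (b 1).toNat with hβ₁
  set β₂ := (b 2).toNat with hβ₂
  have hz1 : ((β₁ : ℕ) : ℤ) = b 1 := Int.toNat_of_nonneg h1
  have hz2 : ((β₂ : ℕ) : ℤ) = b 2 := Int.toNat_of_nonneg h2
  have hN1 : (b 0 + 1).toNat = β₁ + β₂ + 1 := by omega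
  have q1 : ((b 1 : ℤ) : ℚ) = (β₁ : ℚ) := by rw [← hz1]; norm_cast
  have q2 : ((b 2 : ℤ) : ℚ) = (β₂ : ℚ) := by rw [← hz2]; norm_cast
  have e01 : ((b 0 - b 1 + 1 : ℤ) : ℚ) = (β₂ : ℚ) + 1 := by
    have : (b 0 - b 1 + 1 : ℤ) = (β₂ : ℤ) + 1 := by omega
    rw [this]; push_cast; ring
  have e02 : ((b 0 - b 2 + 1 : ℤ) : ℚ) = (β₁ : ℚ) + 1 := by
    have : (b 0 - b 2 + 1 : ℤ) = (β₁ : ℤ) + 1 := by omega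
    rw [this]; push_cast; ring
  -- the two slot identities `(X)_{β₁}(X+β₁)(X+β₁+1)_{β₂} = (X)_{N+1}` and its mirror
  have hA : pochPoly 0 β₁ * (X + C (β₁ : ℚ)) * pochPoly ((β₁ : ℚ) + 1) β₂ = pochPoly 0 (β₁ + β₂ + 1) := by
    rw [show β₁ + β₂ + 1 = β₁ + (β₂ + 1) by ring, pochPoly_zero_add β₁ (β₂ + 1), pochPoly_succ_left]; ring
  have hB : pochPoly 0 β₂ * (X + C (β₂ : ℚ)) * pochPoly ((β₂ : ℚ) + 1) β₁ = pochPoly 0 (β₁ + β₂ + 1) := by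
    rw [show β₁ + β₂ + 1 = β₂ + (β₁ + 1) by ring, pochPoly_zero_add β₂ (β₁ + 1), pochPoly_succ_left]; ring
  have hAB : pochPoly 0 β₁ * pochPoly ((β₂ : ℚ) + 1) β₁ * (pochPoly 0 β₂ * pochPoly ((β₁ : ℚ) + 1) β₂) *
      ((X + C (β₁ : ℚ)) * (X + C (β₂ : ℚ))) = pochPoly 0 (β₁ + β₂ + 1) * pochPoly 0 (β₁ + β₂ + 1) := by
    calc _ = (pochPoly 0 β₁ * (X + C (β₁ : ℚ)) * pochPoly ((β₁ : ℚ) + 1) β₂) *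
          (pochPoly 0 β₂ * (X + C (β₂ : ℚ)) * pochPoly ((β₂ : ℚ) + 1) β₁) := by ring
      _ = _ := by rw [hA, hB]
  have pz : ∀ x : ℚ, pochPoly x 0 = 1 := fun x => by simp [pochPoly]
  have hF0 : faceShape b 0 = b 0 := by rw [faceShape_apply]; simp
  have hF1 : faceShape b (0 + 1) = b 0 + 1 := by rw [faceShape_apply]; simp
  have hF2 : faceShape b (1 + 1) = 0 := by rw [faceShape_apply]; simp
  unfold numPoly
  rw [hF0]
  have hsplit : ∀ F : ℕ → ℚ[X], ∏ j ∈ range 7, F j = F 0 * F (0 + 1) * ∏ k ∈ range 5, F (k + 1 + 1) := by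
    intro F
    rw [prod_range_succ' _ 6, prod_range_succ' _ 5]
    ring
  rw [hsplit, hsplit (fun j => pochPoly 0 (b (j + 1)).toNat * pochPoly ((b 0 - b (j + 1) + 1 : ℤ) : ℚ) (b (j + 1)).toNat)]
  have hrest : ∏ k ∈ range 5, pochPoly 0 (faceShape b (k + 1 + 1 + 1)).toNat *
        pochPoly ((b 0 - faceShape b (k + 1 + 1 + 1) + 1 : ℤ) : ℚ) (faceShape b (k + 1 + 1 + 1)).toNat =
      ∏ k ∈ range 5, pochPoly 0 (b (k + 1 + 1 + 1)).toNat *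
        pochPoly ((b 0 - b (k + 1 + 1 + 1) + 1 : ℤ) : ℚ) (b (k + 1 + 1 + 1)).toNat := by
    refine prod_congr rfl fun k _ => ?_
    rw [faceShape_apply, if_neg (by omega), if_neg (by omega)]
  rw [hrest, hF1, hF2, hN1, show b (0 + 1) = b 1 from rfl, show b (1 + 1) = b 2 from rfl,
    show ((0 : ℤ)).toNat = 0 from rfl, show (b 1).toNat = β₁ from rfl, show (b 2).toNat = β₂ from rfl]
  have e1 : ((b 0 - (b 0 + 1) + 1 : ℤ) : ℚ) = 0 := by push_cast; ring
  rw [e1, e01, e02, q1, q2, ← hAB]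
  simp only [pz]
  ring

/-- `b♭` lies in the box, at level `N`, with `Σ_j b♭_j = Σ_j b_j + 1` — for the extended face `b₁ + b₂ = N`. -/
theorem faceShape_box_ext (b : ℕ → ℤ) (hb : InBox b) (h12 : b 1 + b 2 = b 0) :
    InBox (faceShape b) ∧ faceShape b 0 = b 0 ∧
      ∑ j ∈ range 7, faceShape b (j + 1) = (∑ j ∈ range 7, b (j + 1)) + 1 := by
  have hv : ∀ k, faceShape b k = if k = 2 then 0 else if k = 1 then b 0 + 1 else b k := faceShape_apply b
  have hF0 : faceShape b 0 = b 0 := by rw [hv]; simp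
  refine ⟨⟨by rw [hF0]; exact hb.1, fun j hj => ?_⟩, hF0, ?_⟩
  · rw [hF0, hv]
    have hj' := mem_range.1 hj
    have h0 := hb.1
    by_cases h2 : j + 1 = 2
    · rw [if_pos h2]; omega
    · rw [if_neg h2]
      by_cases h1 : j + 1 = 1
      · rw [if_pos h1]; omega
      · rw [if_neg h1]; exact hb.2 j hj
  · simp only [sum_range_succ, sum_range_zero, hv]
    norm_num
    omega

/-- **Level descent on the extended face `b₁ + b₂ = N`** (the `c₁₂ = 0` base of the induction, with the weight `Ω₀ = U(b)`):
for `N ≥ 1`, `d(b) ≥ 0`, `j ∈ {3,…,7}` with `b_j ≤ N`, writing `b′ = b + e_j` and `b♭ = (N; N+1, 0, b₃,…,b₇)`: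
`U(b♭) = 0`, `U(b′) = (b_j(N−b_j) − b₁b₂)·U(b)`, `U(b)W(b′) − U(b′)W(b) = U(b)·W(b♭)`, `U(b)V(b′) − U(b′)V(b) = U(b)·V(b♭)`.
Proof = P1's `levelDescent_face` with `numPoly_faceShape_ext` in place of `numPoly_faceShape`. -/
theorem levelDescent_faceExt (b : ℕ → ℤ) (hb : InBox b) (h12 : b 1 + b 2 = b 0) (hN1 : 1 ≤ b 0)
    (hd : 0 ≤ dOf b) {j : ℕ} (hj : j ∈ Icc 3 7) (hjN : b j ≤ b 0) :
    coeffU (faceShape b) = 0 ∧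
    coeffU (Function.update b j (b j + 1)) = ((b j : ℚ) * ((b 0 : ℚ) - b j) - (b 1 : ℚ) * (b 2 : ℚ)) * coeffU b ∧
    coeffU b * coeffW (Function.update b j (b j + 1)) - coeffU (Function.update b j (b j + 1)) * coeffW b =
      coeffU b * coeffW (faceShape b) ∧
    coeffU b * coeffV (Function.update b j (b j + 1)) - coeffU (Function.update b j (b j + 1)) * coeffV b =
      coeffU b * coeffV (faceShape b) := by
  obtain ⟨hj3, hj7⟩ := mem_Icc.1 hj
  obtain ⟨i, rfl⟩ : ∃ i, j = i + 1 := ⟨j - 1, by omega⟩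
  have hi7 : i ∈ range 7 := mem_range.2 (by omega)
  have hβ0 : 0 ≤ b (i + 1) := (hb.2 i hi7).1
  have hb1 : 0 ≤ b 1 := (hb.2 0 (mem_range.2 (by norm_num))).1
  have hb2 : 0 ≤ b 2 := (hb.2 1 (mem_range.2 (by norm_num))).1
  have hN : 1 ≤ (b 0).toNat := by omega
  obtain ⟨hbF, hF0, hFsum⟩ := faceShape_box_ext b hb h12
  have hs : ∑ j ∈ range 7, b (j + 1) ≤ 3 * b 0 + 1 := sum_le_of_dOf b hd
  have hsF : ∑ j ∈ range 7, faceShape b (j + 1) ≤ 3 * faceShape b 0 + 1 := by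
    rw [hFsum, hF0]; unfold dOf at hd; omega
  obtain ⟨hb', hs'⟩ := box_update b hb hd hi7 hjN
  -- the exact three-term numerator identity (zero telescoper)
  set κ : ℚ := (b 1 : ℚ) * (b 2 : ℚ) - (b (i + 1) : ℚ) * ((b 0 : ℚ) - b (i + 1)) with hκ
  have e1 : numPoly (Function.update b (i + 1) (b (i + 1) + 1)) =
      numPoly b * ((X + C (b (i + 1) : ℚ)) * (X + C ((b 0 - b (i + 1) : ℤ) : ℚ))) := numPoly_update b hi7 hβ0
  have e2 := numPoly_faceShape_ext b hb1 hb2 h12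
  have hsum : (b 1 : ℚ) + (b 2 : ℚ) = (b 0 : ℚ) := by exact_mod_cast h12
  have hrel : C (1 : ℚ) * numPoly (faceShape b) + C (-1 : ℚ) * numPoly (Function.update b (i + 1) (b (i + 1) + 1)) +
      C (-κ) * numPoly b = (0 : ℚ[X]).comp (X + C 1) * X ^ 6 - 0 * (X + C (((b 0).toNat : ℕ) : ℚ)) ^ 6 := by
    rw [e1, e2, zero_comp, zero_mul, zero_mul, sub_zero, hκ]
    simp only [Int.cast_sub, map_sub, map_mul, map_neg, map_one]
    have hC : C (b 0 : ℚ) = C (b 1 : ℚ) + C (b 2 : ℚ) := by rw [← map_add, hsum]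
    rw [hC]
    ring
  have hg : (0 : ℚ[X]).natDegree + 1 ≤ 6 * (b 0).toNat := by rw [natDegree_zero]; omega
  obtain ⟨hU, hW⟩ := coeff_rel_of_summable (faceShape b) (Function.update b (i + 1) (b (i + 1) + 1)) b (b 0).toNat hN
    hbF hb' hb hsF hs' hs (by rw [hF0]) (by rw [Function.update_of_ne (by omega)]) rfl 1 (-1) (-κ) 0 hg hrel
  have hV := coeffV_rel_of_summable4 (faceShape b) (Function.update b (i + 1) (b (i + 1) + 1)) b b (b 0).toNat hN
    hbF hb' hb hb hsF hs' hs hs (by rw [hF0]) (by rw [Function.update_of_ne (by omega)]) rfl rfl 1 (-1) (-κ) 0 0 hg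
    (by rw [map_zero, zero_mul, add_zero]; exact hrel)
  rw [eval_zero, zero_div] at hV
  -- U of the degenerate shape vanishes: (X)_{N+1}² ∣ numPoly b♭
  have hU0 : coeffU (faceShape b) = 0 := by
    refine coeffU_eq_zero_of_sq_dvd (faceShape b) hbF hsF ?_
    have h01 : (0 : ℕ) ∈ range 7 := mem_range.2 (by norm_num)
    have hslot1 : pochPoly 0 (faceShape b (0 + 1)).toNat *
        pochPoly ((faceShape b 0 - faceShape b (0 + 1) + 1 : ℤ) : ℚ) (faceShape b (0 + 1)).toNat =
        pochPoly 0 ((faceShape b 0).toNat + 1) ^ 2 := by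
      rw [show faceShape b (0 + 1) = b 0 + 1 by rw [faceShape_apply]; simp, hF0,
        show (b 0 + 1).toNat = (b 0).toNat + 1 by have := hb.1; omega,
        show ((b 0 - (b 0 + 1) + 1 : ℤ) : ℚ) = 0 by push_cast; ring, pow_two]
    unfold numPoly
    refine Dvd.dvd.mul_left ?_ _
    rw [← hslot1]
    exact dvd_prod_of_mem _ h01
  refine ⟨hU0, ?_, ?_, ?_⟩
  · rw [hκ] at hU
    linear_combination -hU + hU0
  · linear_combination (-coeffU b) * hW + coeffW b * hU + (-coeffW b) * hU0
  · linear_combination (-coeffU b) * hV + coeffV b * hU + (-coeffV b) * hU0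

end LevelDescent

/-- STATEMENT (PROVED below as `ldFaceWedge_holds`): the slot-7 instance on the extended face `b₁ + b₂ = N` — the wedge functionals the induction
uses (`casUW b`, `casUV b` = the slot-7 wedges) equal `U(b)·W(b♭)`, `U(b)·V(b♭)`, and `U(b♭) = 0`. -/
def ldFaceWedge_stmt : Prop :=
  ∀ b : ℕ → ℤ, InBox b → b 1 + b 2 = b 0 → 1 ≤ b 0 → 0 ≤ dOf b → b 7 ≤ b 0 →
    coeffU (LevelDescent.faceShape b) = 0 ∧
    coeffU b * coeffW (Function.update b 7 (b 7 + 1)) - coeffU (Function.update b 7 (b 7 + 1)) * coeffW b =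
      coeffU b * coeffW (LevelDescent.faceShape b) ∧
    coeffU b * coeffV (Function.update b 7 (b 7 + 1)) - coeffU (Function.update b 7 (b 7 + 1)) * coeffV b =
      coeffU b * coeffV (LevelDescent.faceShape b)

/-- `ldFaceWedge_stmt` holds. -/
theorem ldFaceWedge_holds : ldFaceWedge_stmt := by
  intro b hb h12 hN hd h7
  obtain ⟨h0, -, hW, hV⟩ := LevelDescent.levelDescent_faceExt b hb h12 hN hd (j := 7) (by simp) h7
  exact ⟨h0, hW, hV⟩

end Summit.KontsevichZagierPeriods.Zeta5Search.WedgeDictionary
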